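import Mathlib
import HarnessLib
import Summits.HubbardSuperconductivity.HubbardSuperconductivity.Theorems.KLProgrammeKLRegimeTwoVolumeTorusBlocks

/-!
# Route `KLProgramme` — crux K3, the nested two-volume pass: the NEAR / ZONE / FAR geometry of a deep pin on the coarse torus
# (the hypothesis `hZ` of `…TwoVolumeSubstitutionGluingBound/Winding/DeepPin`; cell gate-hubbard-kl, seat hubbard-kl-k3c4-p1 g8; `--supports` stmt-…-20440)

In the substitution–gluing bracket at a deep pin (`…TwoVolumeSubstitutionGluingBound.sum_pinned_crossBlock_le`, `…Winding.sum_pinned_winding_le`,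
`…DeepPin.sum_norm_kernel_map_glue_sub_glue_map_le`) the coarse in-labels carry three predicates relative to the projected pin `w̄` (a site of the
coarse torus `(ℤ/Lℤ)^d`): `Near y` = «within torus distance `R` of `w̄`», `Z y′` = «in the zone: not `R₀`-deep in the box, i.e. some coordinate
representative `< R₀` or `≥ L − R₀`», `Far y y′` = «torus distance `> R₁`»; the bracket needs `Near y → Z y′ → Far y y′`.  Here this is proved for a pin
whose projection is `(R₀ + R + R₁)`-deep (`far_of_near_of_not_deep`, site level; `far_of_near_of_not_deep_label`, any label type read through a site
projection) — residue arithmetic of `…TwoVolumeTorusBlocks.far_of_not_deep_of_deep` on the coarse torus itself (`b = 1`) plus the triangle inequality of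
`Torus.tnorm`.  Everything is proved; no definition.
-/

noncomputable section

namespace Summit.HubbardSuperconductivity.HubbardSuperconductivity.Theorems.TwoVolumeDefect

set_option linter.dupNamespace false -- summit = problem name (single-conjunct summit), D-0017

open Finset Literature.Probability.LatticeModels

variable {d L : ℕ} [NeZero L]

/-- **A zone site is far from every site near a deep pin.**  If the pin `w̄` is `(R₀ + R + R₁)`-deep (every coordinate representative in
`[R₀+R+R₁, L − (R₀+R+R₁))`), `y` is within torus distance `R` of `w̄`, and `y′` is NOT `R₀`-deep, then `R₁ < tnorm (y − y′)`. [folklore] -/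
theorem far_of_near_of_not_deep {R₀ R R₁ : ℕ} {wbar y y' : TorusSite d L}
    (hw : ∀ j, R₀ + (R + R₁) ≤ (wbar j).val ∧ (wbar j).val + (R₀ + (R + R₁)) < L)
    (hnear : Torus.tnorm (y - wbar) ≤ R) (hzone : ¬ ∀ j, R₀ ≤ (y' j).val ∧ (y' j).val + R₀ < L) :
    R₁ < Torus.tnorm (y - y') := by
  have hmod : ∀ (z : TorusSite d L) (j : Fin d), (z j).val % L = (z j).val := fun z j => Nat.mod_eq_of_lt (ZMod.val_lt _)
  -- the zone site is `(R + R₁)`-far from the deep pin (coarse torus as its own single block)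
  have hfar : R + R₁ < Torus.tnorm (y' - wbar) := by
    refine far_of_not_deep_of_deep (d := d) (b := 1) (m := L) (M := L) (one_mul L).symm (R := R₀) (R' := R + R₁) ?_ ?_
    · simpa only [hmod] using hzone
    · simpa only [hmod] using hw
  -- triangle inequality: `tnorm (y′ − w̄) ≤ tnorm (y − w̄) + tnorm (y − y′)`
  have htri : Torus.tnorm (y' - wbar) ≤ Torus.tnorm (y - wbar) + Torus.tnorm (y - y') := by
    have h := Torus.tnorm_add_le (y - wbar) (-(y - y'))
    rw [show y - wbar + -(y - y') = y' - wbar by abel] at h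
    exact h.trans (add_le_add le_rfl (Torus.tnorm_neg_le _))
  omega

/-- **Label form**: for any label type read through a site projection `site : Γ → (ℤ/Lℤ)^d`, with `Near y := tnorm (site y − w̄) ≤ R`,
`Z y′ := ¬ (R₀-deep (site y′))`, `Far y y′ := R₁ < tnorm (site y − site y′)`: a `(R₀+R+R₁)`-deep pin gives `Near y → Z y′ → Far y y′`
(hypothesis `hZ` of the substitution–gluing bracket). [folklore] -/
theorem far_of_near_of_not_deep_label {Γ : Type*} (site : Γ → TorusSite d L) {R₀ R R₁ : ℕ} {wbar : TorusSite d L}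
    (hw : ∀ j, R₀ + (R + R₁) ≤ (wbar j).val ∧ (wbar j).val + (R₀ + (R + R₁)) < L) (y y' : Γ)
    (hnear : Torus.tnorm (site y - wbar) ≤ R) (hzone : ¬ ∀ j, R₀ ≤ (site y' j).val ∧ (site y' j).val + R₀ < L) :
    R₁ < Torus.tnorm (site y - site y') :=
  far_of_near_of_not_deep hw hnear hzone

omit [NeZero L] in
/-- **Depth is monotone**: a `D`-deep site is `D′`-deep for `D′ ≤ D`. [folklore] -/
theorem deep_mono {D D' : ℕ} (hD : D' ≤ D) {w : TorusSite d L} (hw : ∀ j, D ≤ (w j).val ∧ (w j).val + D < L) :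
    ∀ j, D' ≤ (w j).val ∧ (w j).val + D' < L := fun j => ⟨hD.trans (hw j).1, by have := (hw j).2; omega⟩

/-- **Sites near a deep pin are deep**: if `w̄` is `(D + R)`-deep and `tnorm (y − w̄) ≤ R` then `y` is `D`-deep (depth bookkeeping `R_n = R_{n−1} + r_n` of the
inductive two-volume comparison: the near region of a deeper pin lies inside the previous deep region). [folklore] -/
theorem deep_of_near_of_deep {D R : ℕ} {wbar y : TorusSite d L} (hw : ∀ j, D + R ≤ (wbar j).val ∧ (wbar j).val + (D + R) < L)
    (hnear : Torus.tnorm (y - wbar) ≤ R) : ∀ j, D ≤ (y j).val ∧ (y j).val + D < L := by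
  by_contra h
  have hmod : ∀ (z : TorusSite d L) (j : Fin d), (z j).val % L = (z j).val := fun z j => Nat.mod_eq_of_lt (ZMod.val_lt _)
  have hfar : R < Torus.tnorm (y - wbar) := by
    refine far_of_not_deep_of_deep (d := d) (b := 1) (m := L) (M := L) (one_mul L).symm (R := D) (R' := R) ?_ ?_
    · simpa only [hmod] using h
    · simpa only [hmod] using hw
  omega

end Summit.HubbardSuperconductivity.HubbardSuperconductivity.Theorems.TwoVolumeDefect

end
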